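import Summits.BirchSwinnertonDyer.BirchSwinnertonDyer.Theorems.AdditiveKolyvaginRoadRamifiedHabitatSignLawAnyLevel
import Summits.BirchSwinnertonDyer.BirchSwinnertonDyer.Theorems.AdditiveKolyvaginRoadRamifiedHabitatSignLawGlobalMinimal
import HarnessLib

/-!
# Route `AdditiveKolyvaginRoad`, crux KS′ `LevelKolyvaginSystemsAdditive` (stmt-BirchSwinnertonDyer-21396), card `ramified-toric-habitat` —
# the RAMIFIED-HABITAT SIGN LAW for arbitrary reduction off `p`: FIELD form and GLOBAL-MINIMAL form

Cell `pub/bsd-wall`, width seat `bsd-wall-akr-p2x-w2` g12; `--supports stmt-BirchSwinnertonDyer-21396` (helper). THEOREMS ONLY; no definition,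
no named fact, no `sorry`. BSD is not proved by any of this; KS′/KPA′ stay OPEN at `p² ∣ N`.

Sequel of `…RamifiedHabitatSignLawAnyLevel` (the `±1` dichotomy on the six potentially good non-`I₀*` types for ANY `M = N/p²`). Here:

* §11 `ramifiedHabitat_data_of_discr_anyLevel` — g11's `ramifiedHabitat_data_of_discr` (the habitat `K′` as a FIELD ⟹ the integer data
  `d_{K′} = p*·d'`, `d' ≡ 1 (4)` squarefree, `(d', M p²) = 1`, `p*·d' < 0`) for ANY `M ≠ 0`.
* §12 `rootNumber_mul_rootNumber_twist_discr_anyLevel_eq_one_of_not_dvd` / `…_eq_neg_one_of_dvd` — field form of the dichotomy (`K′` imaginary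
  quadratic, `d_{K′}` odd, `p ∣ d_{K′}`, every prime of `M` split in `K′`), six types, ANY `M`.
* §13 `signLaw_supercuspidal_of_isGloballyMinimal_anyLevel` / `signLaw_principalSeries_of_isGloballyMinimal_anyLevel` — g11's headline forms
  (§11 of `…SignLawGlobalMinimal`: `a := ord_p Δ_min`, `p ∣ c₄(W_ℤ)`, `c₄ = 0 ∨ a ≤ 3 ord_p c₄`) WITHOUT `Squarefree M`.
The sketch's own binders (`Addv W p`, `¬ W.semistabilityDefectAt p ∣ p − 1`, `OtherBadPrimesSplit`, no cofactor `M` at all) follow in the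
sequel `…RamifiedHabitatSignLawAnyLevelSketch`.

CONDITIONAL (as the whole series) on the Modularity Theorem (`exists_isNewformOf`) and Kellock–Dokchitser's Rem. 2.2 at `p` for `E`, `E^{(p*)}`
(named fact `atkinLehnerEigenvalueAt_eq_localRootNumberAt`). BSD is not proved by any of this.

References: [cite: Rohrlich1993Compositio, Prop. 2(iv)] [cite: KellockDokchitser2023, Rem. 2.2] [cite: Serre1972, §5.6 (p. 312)]
[cite: SilvermanATAEC1994, IV Table 4.1] [cite: MurtyMurty1997, Ch. 6 §1].
-/

set_option autoImplicit false
set_option linter.dupNamespace false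

noncomputable section

open scoped Classical MatrixGroups NumberTheorySymbols

open CongruenceSubgroup IsDedekindDomain IsDedekindDomain.HeightOneSpectrum NumberField Rat.HeightOneSpectrum
  WeierstrassCurve Literature.NumberTheory.EllipticCurves Literature.NumberTheory.EllipticCurves.ModularForms
  IsDiscreteValuationRing

namespace Summit.BirchSwinnertonDyer.BirchSwinnertonDyer.Theorems.AdditiveKoly.RamifiedHabitat

/-! ## §11 The habitat as a field, any `M` -/

section Field

variable {p : ℕ} [Fact p.Prime]

/-- **The habitat as a field, ANY `M ≠ 0`.** For an imaginary quadratic `K′` with ODD discriminant `d` divisible by `p` such that every prime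
`q ∣ M` SPLITS in `K′` (`(d/q) = 1` for odd `q`, `d ≡ 1 (mod 8)` if `q = 2`), the cofactor `d'` has `d = p*·d'`, `d' ≡ 1 (4)` squarefree,
`(d', M p²) = 1`, `p*·d' < 0` — g11's `ramifiedHabitat_data_of_discr` with `Squarefree M` replaced by `M ≠ 0` (coprimality to `M = ∏ q^{v_q(M)}`
prime by prime). [cite: SilvermanAEC2009, X.2 and App. C §16] -/
theorem ramifiedHabitat_data_of_discr_anyLevel {M : ℕ} (hp2 : p ≠ 2) (hM0 : M ≠ 0)
    (K : Type) [Field K] [NumberField K] (hK : IsImaginaryQuadratic K) (hKodd : Odd (NumberField.discr K))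
    (hpd : (p : ℤ) ∣ NumberField.discr K)
    (hodd : ∀ q ∈ M.primeFactors, q ≠ 2 → J(NumberField.discr K | q) = 1)
    (htwo : 2 ∣ M → NumberField.discr K % 8 = 1) :
    ∃ d' : ℤ, NumberField.discr K = (-1 : ℤ) ^ (p / 2) * p * d' ∧ d' % 4 = 1 ∧ Squarefree d' ∧
      Int.gcd d' (M * p ^ 2 : ℕ) = 1 ∧ (-1 : ℤ) ^ (p / 2) * p * d' < 0 := by
  have hp : p.Prime := Fact.out
  set d := NumberField.discr K with hd
  obtain ⟨hd4, hdsq⟩ : d % 4 = 1 ∧ Squarefree d := by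
    rcases Literature.NumberTheory.QuadraticFields.Quadratic.isFundamentalDiscriminant_discr (K := K) hK.1 with
      ⟨h4, hsq, -⟩ | ⟨h4, -, -⟩
    · exact ⟨h4, hsq⟩
    · exfalso
      obtain ⟨k, hk⟩ := h4
      obtain ⟨m, hm⟩ := hKodd
      omega
  have hdneg : d < 0 := IsImaginaryQuadratic.discr_neg hK
  obtain ⟨k, hk⟩ := hpd
  set s : ℤ := (-1 : ℤ) ^ (p / 2) with hs
  have hs2 : s * s = 1 := by
    rw [hs, ← pow_two, ← pow_mul]
    exact Even.neg_one_pow ⟨p / 2, by ring⟩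
  have hdeq : d = s * p * (s * k) := by
    calc d = (s * s) * (p * k) := by rw [hs2, one_mul, hk]
      _ = s * p * (s * k) := by ring
  refine ⟨s * k, hdeq, ?_, ?_, ?_, ?_⟩
  · -- `d' ≡ 1 (mod 4)`
    have hp' := (Nat.Prime.eq_two_or_odd hp).resolve_left hp2
    have hpk : (p * k) % 4 = 1 := by rw [← hk]; exact hd4
    rw [Int.mul_emod] at hpk
    rcases Nat.odd_mod_four_iff.mp hp' with hp4 | hp4
    · rw [hs, ZMod.neg_one_pow_div_two_of_one_mod_four hp4, one_mul]
      have : (p : ℤ) % 4 = 1 := by exact_mod_cast hp4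
      rw [this, one_mul, Int.emod_emod_of_dvd _ (by norm_num : (4 : ℤ) ∣ 4)] at hpk
      exact hpk
    · rw [hs, ZMod.neg_one_pow_div_two_of_three_mod_four hp4]
      have : (p : ℤ) % 4 = 3 := by exact_mod_cast hp4
      rw [this] at hpk
      omega
  · -- squarefree: `d' ∣ d`
    exact hdsq.squarefree_of_dvd ⟨s * p, by rw [hk]; linear_combination (-(p * k)) * hs2⟩
  · -- coprime to `M p²`
    rw [← Int.isCoprime_iff_gcd_eq_one]
    push_cast
    refine IsCoprime.mul_right ?_ (IsCoprime.pow_right ?_)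
    · -- at the primes of `M = ∏ q^{v_q(M)}`: they split, so `q ∤ d ⊇ d'`
      have hMprod : (M : ℤ) = ∏ q ∈ M.primeFactors, (q : ℤ) ^ M.factorization q := by
        conv_lhs => rw [Nat.prod_primeFactors_pow_factorization hM0]
        push_cast
        rfl
      rw [hMprod]
      refine IsCoprime.prod_right fun q hq ↦ IsCoprime.pow_right ?_
      have hqp : q.Prime := Nat.prime_of_mem_primeFactors hq
      have hqZ : Prime (q : ℤ) := Nat.prime_iff_prime_int.mp hqp
      refine (Prime.coprime_iff_not_dvd hqZ).mpr (fun hqd' ↦ ?_) |>.symm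
      have hqd : (q : ℤ) ∣ d := by rw [hdeq]; exact Dvd.dvd.mul_left hqd' _
      by_cases hq2 : q = 2
      · subst hq2
        have h8 := htwo (Nat.dvd_of_mem_primeFactors hq)
        omega
      · haveI : NeZero q := ⟨hqp.ne_zero⟩
        have hJ := hodd q hq hq2
        have h0 : J(d | q) = 0 := jacobiSym.eq_zero_iff_not_coprime.mpr (by
          intro hc
          have hc' : IsCoprime d (q : ℤ) := Int.isCoprime_iff_gcd_eq_one.mpr hc
          exact hqZ.not_unit (hc'.isUnit_of_dvd' hqd (dvd_refl _)))
        rw [h0] at hJ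
        exact zero_ne_one hJ
    · -- at `p`: `p² ∤ d` (squarefree)
      have hpZ : Prime (p : ℤ) := Nat.prime_iff_prime_int.mp hp
      refine (Prime.coprime_iff_not_dvd hpZ).mpr (fun hpd' ↦ ?_) |>.symm
      have : (p : ℤ) * p ∣ d := by rw [hdeq]; exact mul_dvd_mul (dvd_mul_left _ _) hpd'
      exact hp.ne_one (by
        have hu := hdsq (p : ℤ) this
        exact_mod_cast Int.isUnit_iff_natAbs_eq.mp hu)
  · -- negative
    rw [← hdeq]; exact hdneg

/-! ## §12 Field form of the dichotomy, six types, any `M` -/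

/-- **THE RAMIFIED-HABITAT SIGN LAW, FIELD FORM — supercuspidal half, ANY `M`.** `E/ℚ` elliptic, `N_E = M·p²` (`p ≥ 5`, `p ∤ M`, no further
hypothesis on `M`), at `p` one of the six types II/III/IV/IV*/III*/II* (`ord Δ = a ∈ {2,3,4,8,9,10}` on the chosen `ℤ_p`-minimal model, `ord c₄ > 0`,
`3 ord c₄ ≥ ord Δ`), `e := 12/gcd(a,12)`; `K′` imaginary quadratic with `d_{K′}` odd, `p ∣ d_{K′}`, every prime of `M` split in `K′`. If `e ∤ p − 1`
then `w(E)·w(E^{(d_{K′})}) = +1`. Conditional on {hmod, F1 at `p`}; BSD is not proved by this.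
[cite: Rohrlich1993Compositio, Prop. 2(iv)] [cite: KellockDokchitser2023, Rem. 2.2] -/
theorem rootNumber_mul_rootNumber_twist_discr_anyLevel_eq_one_of_not_dvd (W : WeierstrassCurve ℚ) [W.IsElliptic]
    (hmod : exists_isNewformOf) (hF1 : W.atkinLehnerEigenvalueAt_eq_localRootNumberAt)
    (hF1' : (W.quadraticTwist (((-1 : ℤ) ^ (p / 2) * p : ℤ) : ℚ)).atkinLehnerEigenvalueAt_eq_localRootNumberAt)
    (hp5 : 5 ≤ p) {M : ℕ} (hN : W.conductorNorm ℤ = M * p ^ 2) (hpM : ¬ p ∣ M) {a : ℕ}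
    (hΔ : addVal ℤ_[p] (((W.baseChange ℚ_[p]).minimal ℤ_[p]).integralModel ℤ_[p]).Δ = a)
    (ha : a = 2 ∨ a = 3 ∨ a = 4 ∨ a = 8 ∨ a = 9 ∨ a = 10)
    (hc₄ : addVal ℤ_[p] (((W.baseChange ℚ_[p]).minimal ℤ_[p]).integralModel ℤ_[p]).c₄ ≠ 0)
    (hj : ¬ 3 * addVal ℤ_[p] (((W.baseChange ℚ_[p]).minimal ℤ_[p]).integralModel ℤ_[p]).c₄ <
      addVal ℤ_[p] (((W.baseChange ℚ_[p]).minimal ℤ_[p]).integralModel ℤ_[p]).Δ)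
    (K : Type) [Field K] [NumberField K] (hK : IsImaginaryQuadratic K) (hKodd : Odd (NumberField.discr K))
    (hpd : (p : ℤ) ∣ NumberField.discr K)
    (hodd : ∀ q ∈ M.primeFactors, q ≠ 2 → J(NumberField.discr K | q) = 1)
    (htwo : 2 ∣ M → NumberField.discr K % 8 = 1)
    (hsc : ¬ 12 / Nat.gcd a 12 ∣ p - 1) :
    W.rootNumber * (W.quadraticTwist (NumberField.discr K : ℚ)).rootNumber = 1 := by
  have hM0 : M ≠ 0 := by
    intro h; rw [h, zero_mul] at hN; exact (W.conductorNorm_pos_holds).ne' hN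
  obtain ⟨d', hd, hd'4, hd'sq, hgcd, hneg⟩ := ramifiedHabitat_data_of_discr_anyLevel (by omega) hM0 K hK hKodd hpd hodd htwo
  rw [hd] at hodd htwo ⊢
  rw [← hN] at hgcd
  exact rootNumber_mul_rootNumber_ramifiedTwist_anyLevel_eq_one_of_not_dvd W hmod hF1 hF1' hp5 hN hpM hΔ ha hc₄ hj hd'4 hd'sq hgcd
    hneg hodd htwo hsc

/-- **FIELD FORM — principal-series half, ANY `M`** (same data, potentially good): if `e ∣ p − 1` then `w(E)·w(E^{(d_{K′})}) = −1`.
Conditional on {hmod, F1 at `p`}. [cite: Rohrlich1993Compositio, Prop. 2(iv)] [cite: KellockDokchitser2023, Rem. 2.2] -/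
theorem rootNumber_mul_rootNumber_twist_discr_anyLevel_eq_neg_one_of_dvd (W : WeierstrassCurve ℚ) [W.IsElliptic]
    (hmod : exists_isNewformOf) (hF1 : W.atkinLehnerEigenvalueAt_eq_localRootNumberAt)
    (hF1' : (W.quadraticTwist (((-1 : ℤ) ^ (p / 2) * p : ℤ) : ℚ)).atkinLehnerEigenvalueAt_eq_localRootNumberAt)
    (hp5 : 5 ≤ p) {M : ℕ} (hN : W.conductorNorm ℤ = M * p ^ 2) (hpM : ¬ p ∣ M) {a : ℕ}
    (hΔ : addVal ℤ_[p] (((W.baseChange ℚ_[p]).minimal ℤ_[p]).integralModel ℤ_[p]).Δ = a)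
    (ha : a = 2 ∨ a = 3 ∨ a = 4 ∨ a = 8 ∨ a = 9 ∨ a = 10)
    (hc₄ : addVal ℤ_[p] (((W.baseChange ℚ_[p]).minimal ℤ_[p]).integralModel ℤ_[p]).c₄ ≠ 0)
    (hj : ¬ 3 * addVal ℤ_[p] (((W.baseChange ℚ_[p]).minimal ℤ_[p]).integralModel ℤ_[p]).c₄ <
      addVal ℤ_[p] (((W.baseChange ℚ_[p]).minimal ℤ_[p]).integralModel ℤ_[p]).Δ)
    (K : Type) [Field K] [NumberField K] (hK : IsImaginaryQuadratic K) (hKodd : Odd (NumberField.discr K))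
    (hpd : (p : ℤ) ∣ NumberField.discr K)
    (hodd : ∀ q ∈ M.primeFactors, q ≠ 2 → J(NumberField.discr K | q) = 1)
    (htwo : 2 ∣ M → NumberField.discr K % 8 = 1)
    (hps : 12 / Nat.gcd a 12 ∣ p - 1) :
    W.rootNumber * (W.quadraticTwist (NumberField.discr K : ℚ)).rootNumber = -1 := by
  have hM0 : M ≠ 0 := by
    intro h; rw [h, zero_mul] at hN; exact (W.conductorNorm_pos_holds).ne' hN
  obtain ⟨d', hd, hd'4, hd'sq, hgcd, hneg⟩ := ramifiedHabitat_data_of_discr_anyLevel (by omega) hM0 K hK hKodd hpd hodd htwo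
  rw [hd] at hodd htwo ⊢
  rw [← hN] at hgcd
  exact rootNumber_mul_rootNumber_ramifiedTwist_anyLevel_eq_neg_one_of_dvd W hmod hF1 hF1' hp5 hN hpM hΔ ha hc₄ hj hd'4 hd'sq hgcd
    hneg hodd htwo hps

end Field

/-! ## §13 Headline forms on a global minimal model, any `M` -/

section Headline

variable {p : ℕ} [Fact p.Prime]

/-- **RAMIFIED-HABITAT SIGN LAW, SUPERCUSPIDAL HALF, on a global minimal model, ANY `M`.** As g11's `signLaw_supercuspidal_of_isGloballyMinimal`
WITHOUT `Squarefree M`: `W/ℚ` a GLOBAL MINIMAL model with `N = M·p²` (`p ≥ 5`, `p ∤ M`); at `p`: `a := ord_p Δ_min ∈ {2,3,4,8,9,10}`, `p ∣ c₄(W_ℤ)`,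
`c₄ = 0` or `a ≤ 3·ord_p c₄`; `e := 12/gcd(12, a)`; `K′` imaginary quadratic with `d_{K′}` odd, `p ∣ d_{K′}`, every prime of `M` split in `K′`.
If `e ∤ p − 1` then `w(E)·w(E^{(d_{K′})}) = +1`. Conditional on {hmod, F1 at `p`}; BSD is not proved by this.
[cite: Rohrlich1993Compositio, Prop. 2(iv)] [cite: KellockDokchitser2023, Rem. 2.2] -/
theorem signLaw_supercuspidal_of_isGloballyMinimal_anyLevel (W : WeierstrassCurve ℚ) [W.IsElliptic] [W.IsGloballyMinimal]
    (hmod : exists_isNewformOf) (hF1 : W.atkinLehnerEigenvalueAt_eq_localRootNumberAt)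
    (hF1' : (W.quadraticTwist (((-1 : ℤ) ^ (p / 2) * p : ℤ) : ℚ)).atkinLehnerEigenvalueAt_eq_localRootNumberAt)
    (hp5 : 5 ≤ p) {M : ℕ} (hN : W.conductorNorm ℤ = M * p ^ 2) (hpM : ¬ p ∣ M) {a : ℕ}
    (hΔ : padicValInt p W.minimalDiscriminantInt = a) (ha : a = 2 ∨ a = 3 ∨ a = 4 ∨ a = 8 ∨ a = 9 ∨ a = 10)
    (hpc₄ : (p : ℤ) ∣ W.integralModelInt.c₄)
    (hj : W.integralModelInt.c₄ = 0 ∨ padicValInt p W.minimalDiscriminantInt ≤ 3 * padicValInt p W.integralModelInt.c₄)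
    (K : Type) [Field K] [NumberField K] (hK : IsImaginaryQuadratic K) (hKodd : Odd (NumberField.discr K))
    (hpd : (p : ℤ) ∣ NumberField.discr K)
    (hodd : ∀ q ∈ M.primeFactors, q ≠ 2 → J(NumberField.discr K | q) = 1)
    (htwo : 2 ∣ M → NumberField.discr K % 8 = 1)
    (hsc : ¬ 12 / Nat.gcd a 12 ∣ p - 1) :
    W.rootNumber * (W.quadraticTwist (NumberField.discr K : ℚ)).rootNumber = 1 := by
  obtain ⟨hΔ', hc₄', hj'⟩ := localHypotheses_of_isGloballyMinimal (p := p) W hpc₄ hj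
  rw [hΔ] at hΔ'
  exact rootNumber_mul_rootNumber_twist_discr_anyLevel_eq_one_of_not_dvd W hmod hF1 hF1' hp5 hN hpM hΔ' ha hc₄' hj' K hK hKodd hpd hodd
    htwo hsc

/-- **RAMIFIED-HABITAT SIGN LAW, PRINCIPAL-SERIES HALF (`e ∈ {3,4,6}`, `e ∣ p − 1`), on a global minimal model, ANY `M`**: same data,
`w(E)·w(E^{(d_{K′})}) = −1`. Conditional on {hmod, F1 at `p`}. [cite: Rohrlich1993Compositio, Prop. 2(iv)] [cite: KellockDokchitser2023, Rem. 2.2] -/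
theorem signLaw_principalSeries_of_isGloballyMinimal_anyLevel (W : WeierstrassCurve ℚ) [W.IsElliptic] [W.IsGloballyMinimal]
    (hmod : exists_isNewformOf) (hF1 : W.atkinLehnerEigenvalueAt_eq_localRootNumberAt)
    (hF1' : (W.quadraticTwist (((-1 : ℤ) ^ (p / 2) * p : ℤ) : ℚ)).atkinLehnerEigenvalueAt_eq_localRootNumberAt)
    (hp5 : 5 ≤ p) {M : ℕ} (hN : W.conductorNorm ℤ = M * p ^ 2) (hpM : ¬ p ∣ M) {a : ℕ}
    (hΔ : padicValInt p W.minimalDiscriminantInt = a) (ha : a = 2 ∨ a = 3 ∨ a = 4 ∨ a = 8 ∨ a = 9 ∨ a = 10)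
    (hpc₄ : (p : ℤ) ∣ W.integralModelInt.c₄)
    (hj : W.integralModelInt.c₄ = 0 ∨ padicValInt p W.minimalDiscriminantInt ≤ 3 * padicValInt p W.integralModelInt.c₄)
    (K : Type) [Field K] [NumberField K] (hK : IsImaginaryQuadratic K) (hKodd : Odd (NumberField.discr K))
    (hpd : (p : ℤ) ∣ NumberField.discr K)
    (hodd : ∀ q ∈ M.primeFactors, q ≠ 2 → J(NumberField.discr K | q) = 1)
    (htwo : 2 ∣ M → NumberField.discr K % 8 = 1)
    (hps : 12 / Nat.gcd a 12 ∣ p - 1) :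
    W.rootNumber * (W.quadraticTwist (NumberField.discr K : ℚ)).rootNumber = -1 := by
  obtain ⟨hΔ', hc₄', hj'⟩ := localHypotheses_of_isGloballyMinimal (p := p) W hpc₄ hj
  rw [hΔ] at hΔ'
  exact rootNumber_mul_rootNumber_twist_discr_anyLevel_eq_neg_one_of_dvd W hmod hF1 hF1' hp5 hN hpM hΔ' ha hc₄' hj' K hK hKodd hpd hodd
    htwo hps

end Headline

end Summit.BirchSwinnertonDyer.BirchSwinnertonDyer.Theorems.AdditiveKoly.RamifiedHabitat

end
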